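import Summits.QuantumFields.BalabanUV.Beta.D1BFx.NeedleBondMarginal
import Summits.QuantumFields.BalabanUV.Beta.D1BFx.GhostLegBlockMass
import Summits.QuantumFields.BalabanUV.Beta.D1BFx.LatticeHLSProfiles
import Literature.MathematicalPhysics.QuantumFieldTheory.Balaban1983to89.Beta.DressedMomentNormalisation

/-!
# `BalabanUV.Beta.D1BFx.NeedleNdlNdlCensus` — road «BF-x» for binder row D1, slot (K), END row `hGrp gN`, «GN-33 ∕ NN» CENSUS: the needle weights
# `W(κ,p) = Σ_{s∈B(blk p)} |qJet_p s|` and the two-needle Coulomb functional `M(p,u) = Σ_{s,s′} |qJet_p s|·|qJet_u s′|∕nrm(s−s′)` SUMMED OVER A BLOCK OF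
# BONDS — `Σ_{p∈B(β)} W ≤ n − 1`, `Σ_{s∈B(β)} nrm(s−s′)⁻¹ ≤ c₁n³`, `Σ_{p∈B(β)} M(p,u) ≤ c₁n³·(n−1)n⁻⁴·W(ν,u)`, and the base block of `cellSum`

HONEST DEPENDENCY (cell records, verbatim): «continuum YM on T⁴ ⇐ BetaPertH ∧ nine spine estimates (0/9 proved); BetaPertH ⇐ (D1) ∧ (D4) ∧
CAP+tail; G-an2-4 gates asym, D1 and NE2/3/4.»  HONEST FRAMING (cell contract, verbatim): «discharging `BetaPertH` makes Bałaban's UV stability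
UNCONDITIONAL — a real constructive-QFT result; it is NOT the continuum limit and NOT the Clay problem.»  THIS MODULE DISCHARGES NOTHING of the
wall: [folklore] finite-sum bookkeeping BY NAME over this lineage's bond marginal M7 (`NeedleBondMarginal.sum_bond_abs_qJet_le`:
`Σ_{p} |qJet n κ p y s| ≤ (n−1)n⁻⁴` for fixed `(y, s)`), leaf-04-g9's `LatticeHLSProfiles.sum_pow_mul_exp_div_nrm_pow_free_scale_le`, the Literature blocks
(`B6QGQLower276.mem_B` ∕ `chart_mem_B` ∕ `dist_le_of_blk_eq`, `B6QGQDecay237.card_B`) and `DressedMomentNormalisation.resSite`.  No `def`, no `def … : Prop`,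
nothing cited, 0 sorry.  Root-level binders hW ∕ hR-sockets ∕ hSX-socket ∕ D1Tel ∕ D1Rep — 0 discharged; (K) NOT closed; NOT D1, NOT `BetaPertH`, NOT
continuum, NOT Clay.

ABSOLUTE RULE (cell charter, verbatim): «No internally-minted statement may enter as a cited fact. Every hypothesis is either kernel-proved in
this package or a verbatim quotation of a PUBLISHED theorem with page reference. The manuscript(s) under audit are NOT citable for their own
disputed steps — they are the thing under adjudication; programme-internal (2001/route/tribunal) claims are never citable.»

WHY (owner claim table «GN-CELLS» v0.2, R3 cell `ndl ⊗ ndl`; an3-g57 §3′ (4) R3⊗R3 «× partner sum `Σ_{b′ level λ′}|w|²e^{−δ·bd} ≍ n²·n^{4−λ′}` … × base fraction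
`n^{−λ}`» and §2.1 «`Σ_block w = 2(n−1)`»; MINE journal 2026-08-21 l.30734).  The per-pair word bound of `NeedleNdlNdlRow` is `E·(K₁·W_p·W_u + K₂·n·M(p,u))`;
its w-sum is booked block by block (block decay × block MASS), so the cell needs the block sums of `W` and `M` — both reduce to M7 with `(y, s)` FIXED
once `blk p = β` is substituted inside the block (`mem_B`), the Coulomb factor of `M` summed over the block by the kit's damped centre-free sum after
`1 ≤ e·e^{−‖s−v‖∞∕n}` for a block point `v` (`dist_le_of_blk_eq`); the base sites `resSite r` of `cellSum` all have block label `0`.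

CONTENT (`n ≥ 1`).
* [folklore] **`sum_B_W_le`** (`Σ_{p∈B(β)} Σ_{s∈B(blk p)} |qJet_p s| ≤ n − 1`), **`sum_B_inv_nrm_le`** (`Σ_{s∈B(β)} 1∕nrm(s−s′) ≤ c₁·n³`, `c₁` displayed),
  **`sum_B_M_le`**, `blk_resSite`, **`sum_resSite_W_le`** (`Σ_{b∈image resSite} W(ν,b) ≤ n − 1`).
NOT HERE (honest): the word, the cell — `NeedleNdlNdlRow`.
Unit `b2b-balaban-gan24-formalise-leaf-05` (gen 42), G-an2-4 swarm leaf prover on cross-lane kernel duty; `LEAVES-BFx.md` row (N) «GN-33∕NN».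
-/

noncomputable section

namespace Summit.QuantumFields.BalabanUV.Beta.D1BFx.NeedleNdlNdlCensus

open Finset
open scoped BigOperators
open Literature.MathematicalPhysics.QuantumFieldTheory.Balaban1983to89
open Literature.MathematicalPhysics.QuantumFieldTheory.Balaban1983to89.Beta
open B6QGQLower276 (X e blk B mem_B side chart chart_mem_B dist_le_of_blk_eq)
open B6QGQDecay237 (card_B)
open ExpKernelCalculus (Site)
open Beta.PoissonInterior (nrm nrm_pos)
open DyadicShell (Pt)
open DressedMomentNormalisation (resSite)
open Summit.QuantumFields.BalabanUV.Beta.D1BFx.GhostLeg (cast_pred_add_one)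
open Summit.QuantumFields.BalabanUV.Beta.D1BFx.GhostStencil (qJet)
open Summit.QuantumFields.BalabanUV.Beta.D1BFx.GhostLegFree (supNorm_eq)
open Summit.QuantumFields.BalabanUV.Beta.D1BFx.GhostLegBlockMass (dist_eq_supNorm)
open Summit.QuantumFields.BalabanUV.Beta.D1BFx.NeedleBondMarginal (sum_bond_abs_qJet_le)
open Summit.QuantumFields.BalabanUV.Beta.D1BFx.LatticeHLSProfiles (sum_pow_mul_exp_div_nrm_pow_free_scale_le)

variable (n : ℕ) [NeZero n]

/-- [folklore] **BLOCK SUM OF THE NEEDLE WEIGHTS** (M7 = `NeedleBondMarginal.sum_bond_abs_qJet_le` summed over the `n⁴` needle sites of the block):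
`Σ_{p∈B(β)} Σ_{s∈B(blk p)} |qJet n κ p (blk p) s| ≤ n − 1`. -/
theorem sum_B_W_le (κ : Fin 4) (β : Site 4) :
    ∑ p ∈ B (n - 1) β, ∑ s ∈ B (n - 1) (blk (n - 1) p), |qJet n κ p (blk (n - 1) p) s| ≤ (n : ℝ) - 1 := by
  have hn : (0 : ℝ) < n := by exact_mod_cast Nat.pos_of_ne_zero (NeZero.ne n)
  have hmn : (((n - 1 : ℕ) : ℝ) + 1) = n := cast_pred_add_one n
  calc ∑ p ∈ B (n - 1) β, ∑ s ∈ B (n - 1) (blk (n - 1) p), |qJet n κ p (blk (n - 1) p) s|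
      = ∑ p ∈ B (n - 1) β, ∑ s ∈ B (n - 1) β, |qJet n κ p β s| := Finset.sum_congr rfl fun p hp => by rw [mem_B.1 hp]
    _ = ∑ s ∈ B (n - 1) β, ∑ p ∈ B (n - 1) β, |qJet n κ p β s| := Finset.sum_comm
    _ ≤ ∑ _s ∈ B (n - 1) β, ((n : ℝ) - 1) * ((n : ℝ) ^ 4)⁻¹ := Finset.sum_le_sum fun s _ => sum_bond_abs_qJet_le n κ _ β s
    _ = (n : ℝ) - 1 := by
        rw [Finset.sum_const, nsmul_eq_mul, card_B, hmn]; field_simp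

/-- [folklore] **THE COULOMB SUM OVER A BLOCK FROM ANY CENTRE**: `Σ_{s∈B(β)} 1∕nrm(s−s′) ≤ c₁·n³` uniformly in `s′`
(`c₁ = e·2·(1 + 216·(2!·4²·5))`; a block point `v` has `‖s−v‖∞ ≤ n−1`, so `1 ≤ e·e^{−‖s−v‖∕n}` and the kit's damped centre-free sum applies). -/
theorem sum_B_inv_nrm_le (β s' : Site 4) :
    ∑ s ∈ B (n - 1) β, 1 / nrm (s - s') ≤
      Real.exp 1 * (2 * (0 : ℕ).factorial * (2 / (1 : ℝ)) ^ 0 * (1 + 2 * (4 : ℕ) * 3 ^ (4 - 1) * ((4 - 1 - 1).factorial * (4 / (1 : ℝ)) ^ (4 - 1 - 1) * (1 + 4 / (1 : ℝ)))))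
        * (n : ℝ) ^ 3 := by
  have hn : (0 : ℝ) < n := by exact_mod_cast Nat.pos_of_ne_zero (NeZero.ne n)
  have hn1 : 1 ≤ n := NeZero.one_le
  set v : Site 4 := chart (n - 1) β (fun _ => 0) with hv
  have hvB : v ∈ B (n - 1) β := chart_mem_B (n - 1) β _
  have hpt : ∀ s ∈ B (n - 1) β, 1 / nrm (s - s') ≤ Real.exp 1 *
      (((Beta.PoissonInterior.supNorm (s - v) : ℕ) : ℝ) ^ 0 * Real.exp (-(1 / n) * Beta.PoissonInterior.supNorm (s - v)) / nrm (s - s') ^ 1) := by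
    intro s hs
    have hd : dist s v ≤ ((n - 1 : ℕ) : ℝ) := dist_le_of_blk_eq ((mem_B.1 hs).trans (mem_B.1 hvB).symm)
    rw [dist_eq_supNorm s v, supNorm_eq] at hd
    have hm1 : ((n - 1 : ℕ) : ℝ) ≤ n := by have := cast_pred_add_one n; linarith
    have hle : (1 / (n : ℝ)) * (Beta.PoissonInterior.supNorm (s - v) : ℝ) ≤ 1 := by
      rw [div_mul_eq_mul_div, one_mul, div_le_one hn]; exact hd.trans hm1
    have hexp : 1 ≤ Real.exp 1 * Real.exp (-(1 / n) * Beta.PoissonInterior.supNorm (s - v)) := by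
      rw [← Real.exp_add]; exact Real.one_le_exp (by linarith)
    have hnrm := nrm_pos (s - s')
    rw [pow_zero, one_mul, pow_one]
    calc 1 / nrm (s - s') ≤ (Real.exp 1 * Real.exp (-(1 / n) * Beta.PoissonInterior.supNorm (s - v))) / nrm (s - s') :=
          div_le_div_of_nonneg_right hexp hnrm.le
      _ = _ := by ring
  have hkit := sum_pow_mul_exp_div_nrm_pow_free_scale_le (d := 4) (by norm_num) (δ := 1) one_pos hn1 (p := 1) (by norm_num) 0
    (B (n - 1) β) s' v
  calc ∑ s ∈ B (n - 1) β, 1 / nrm (s - s')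
      ≤ ∑ s ∈ B (n - 1) β, Real.exp 1 *
          (((Beta.PoissonInterior.supNorm (s - v) : ℕ) : ℝ) ^ 0 * Real.exp (-(1 / n) * Beta.PoissonInterior.supNorm (s - v)) / nrm (s - s') ^ 1) :=
        Finset.sum_le_sum hpt
    _ = Real.exp 1 * ∑ s ∈ B (n - 1) β,
          ((Beta.PoissonInterior.supNorm (s - v) : ℕ) : ℝ) ^ 0 * Real.exp (-(1 / n) * Beta.PoissonInterior.supNorm (s - v)) / nrm (s - s') ^ 1 := by
        rw [Finset.mul_sum]
    _ ≤ Real.exp 1 * (2 * (0 : ℕ).factorial * (2 / (1 : ℝ)) ^ 0 *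
          (1 + 2 * (4 : ℕ) * 3 ^ (4 - 1) * ((4 - 1 - 1).factorial * (4 / (1 : ℝ)) ^ (4 - 1 - 1) * (1 + 4 / (1 : ℝ)))) * (n : ℝ) ^ (4 - 1 + 0)) :=
        mul_le_mul_of_nonneg_left hkit (Real.exp_pos _).le
    _ = _ := by rw [show (4 - 1 + 0 : ℕ) = 3 by norm_num]; ring

/-- [folklore] **BLOCK SUM OF THE TWO-NEEDLE FUNCTIONAL**: `Σ_{p∈B(β)} M(p,u) ≤ c₁n³·((n−1)n⁻⁴)·W(ν,u)` (bond marginal inside, Coulomb sum outside). -/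
theorem sum_B_M_le (μ ν : Fin 4) (β u : Site 4) :
    ∑ p ∈ B (n - 1) β, ∑ s ∈ B (n - 1) (blk (n - 1) p), ∑ s' ∈ B (n - 1) (blk (n - 1) u),
        |qJet n μ p (blk (n - 1) p) s| * |qJet n ν u (blk (n - 1) u) s'| / nrm (s - s')
      ≤ Real.exp 1 * (2 * (0 : ℕ).factorial * (2 / (1 : ℝ)) ^ 0 * (1 + 2 * (4 : ℕ) * 3 ^ (4 - 1) * ((4 - 1 - 1).factorial * (4 / (1 : ℝ)) ^ (4 - 1 - 1) * (1 + 4 / (1 : ℝ)))))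
        * (n : ℝ) ^ 3 * (((n : ℝ) - 1) * ((n : ℝ) ^ 4)⁻¹) * ∑ s' ∈ B (n - 1) (blk (n - 1) u), |qJet n ν u (blk (n - 1) u) s'| := by
  set c₁ := Real.exp 1 * (2 * (0 : ℕ).factorial * (2 / (1 : ℝ)) ^ 0 *
    (1 + 2 * (4 : ℕ) * 3 ^ (4 - 1) * ((4 - 1 - 1).factorial * (4 / (1 : ℝ)) ^ (4 - 1 - 1) * (1 + 4 / (1 : ℝ))))) with hc₁
  have hn : (0 : ℝ) < n := by exact_mod_cast Nat.pos_of_ne_zero (NeZero.ne n)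
  have hn1 : (1 : ℝ) ≤ n := by exact_mod_cast NeZero.one_le
  have hmarg : 0 ≤ ((n : ℝ) - 1) * ((n : ℝ) ^ 4)⁻¹ := by
    have : 0 ≤ (n : ℝ) - 1 := by linarith
    positivity
  -- rewrite `blk p = β` and move the bond sum inside
  calc ∑ p ∈ B (n - 1) β, ∑ s ∈ B (n - 1) (blk (n - 1) p), ∑ s' ∈ B (n - 1) (blk (n - 1) u),
        |qJet n μ p (blk (n - 1) p) s| * |qJet n ν u (blk (n - 1) u) s'| / nrm (s - s')
      = ∑ p ∈ B (n - 1) β, ∑ s ∈ B (n - 1) β, ∑ s' ∈ B (n - 1) (blk (n - 1) u),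
          |qJet n μ p β s| * |qJet n ν u (blk (n - 1) u) s'| / nrm (s - s') := Finset.sum_congr rfl fun p hp => by rw [mem_B.1 hp]
    _ = ∑ s ∈ B (n - 1) β, ∑ s' ∈ B (n - 1) (blk (n - 1) u), ∑ p ∈ B (n - 1) β,
          |qJet n μ p β s| * |qJet n ν u (blk (n - 1) u) s'| / nrm (s - s') := by
        rw [Finset.sum_comm]
        exact Finset.sum_congr rfl fun s _ => Finset.sum_comm
    _ = ∑ s' ∈ B (n - 1) (blk (n - 1) u), ∑ s ∈ B (n - 1) β, ∑ p ∈ B (n - 1) β,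
          |qJet n μ p β s| * |qJet n ν u (blk (n - 1) u) s'| / nrm (s - s') := Finset.sum_comm
    _ = ∑ s' ∈ B (n - 1) (blk (n - 1) u), |qJet n ν u (blk (n - 1) u) s'| *
          ∑ s ∈ B (n - 1) β, (∑ p ∈ B (n - 1) β, |qJet n μ p β s|) * (1 / nrm (s - s')) := by
        simp only [Finset.mul_sum, Finset.sum_mul]
        exact Finset.sum_congr rfl fun s' _ => Finset.sum_congr rfl fun s _ => Finset.sum_congr rfl fun p _ => by ring
    _ ≤ ∑ s' ∈ B (n - 1) (blk (n - 1) u), |qJet n ν u (blk (n - 1) u) s'| * (((n : ℝ) - 1) * ((n : ℝ) ^ 4)⁻¹ * (c₁ * (n : ℝ) ^ 3)) := by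
        refine Finset.sum_le_sum fun s' _ => mul_le_mul_of_nonneg_left ?_ (abs_nonneg _)
        calc ∑ s ∈ B (n - 1) β, (∑ p ∈ B (n - 1) β, |qJet n μ p β s|) * (1 / nrm (s - s'))
            ≤ ∑ s ∈ B (n - 1) β, ((n : ℝ) - 1) * ((n : ℝ) ^ 4)⁻¹ * (1 / nrm (s - s')) :=
              Finset.sum_le_sum fun s _ => mul_le_mul_of_nonneg_right (sum_bond_abs_qJet_le n μ _ β s)
                (by have := nrm_pos (s - s'); positivity)
          _ = ((n : ℝ) - 1) * ((n : ℝ) ^ 4)⁻¹ * ∑ s ∈ B (n - 1) β, 1 / nrm (s - s') := by rw [Finset.mul_sum]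
          _ ≤ ((n : ℝ) - 1) * ((n : ℝ) ^ 4)⁻¹ * (c₁ * (n : ℝ) ^ 3) := mul_le_mul_of_nonneg_left (sum_B_inv_nrm_le n β s') hmarg
    _ = _ := by rw [← Finset.sum_mul]; ring

omit [NeZero n] in
/-- [folklore] the base sites of `cellSum` lie in the base block: `blk (n−1) (resSite r) = 0` for `r : Fin 4 → Fin n`. -/
theorem blk_resSite (r : Fin 4 → Fin n) : blk (n - 1) (resSite r : Site 4) = 0 := by
  funext i
  show ((r i : ℕ) : ℤ) / side (n - 1) = 0
  have hr : ((r i : ℕ) : ℤ) < n := by exact_mod_cast (r i).isLt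
  have hn : 1 ≤ n := Nat.one_le_iff_ne_zero.mpr (by rintro rfl; exact Fin.elim0 (r i))
  have hs : side (n - 1) = (n : ℤ) := by unfold side; omega
  rw [hs]
  exact Int.ediv_eq_zero_of_lt (Int.natCast_nonneg _) hr

/-- [folklore] **THE BASE SUM OF THE NEEDLE WEIGHTS**: `Σ_{b ∈ image resSite} W(ν,b) ≤ n − 1` (M7 on the base block). -/
theorem sum_resSite_W_le (ν : Fin 4) :
    ∑ b ∈ (univ : Finset (Fin 4 → Fin n)).image resSite, ∑ s ∈ B (n - 1) (blk (n - 1) b), |qJet n ν b (blk (n - 1) b) s| ≤ (n : ℝ) - 1 := by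
  classical
  have hn : (0 : ℝ) < n := by exact_mod_cast Nat.pos_of_ne_zero (NeZero.ne n)
  have hmn : (((n - 1 : ℕ) : ℝ) + 1) = n := cast_pred_add_one n
  have hblk : ∀ b ∈ (univ : Finset (Fin 4 → Fin n)).image resSite, blk (n - 1) b = 0 := by
    intro b hb
    obtain ⟨r, _, rfl⟩ := Finset.mem_image.mp hb
    exact blk_resSite n r
  calc ∑ b ∈ (univ : Finset (Fin 4 → Fin n)).image resSite, ∑ s ∈ B (n - 1) (blk (n - 1) b), |qJet n ν b (blk (n - 1) b) s|
      = ∑ b ∈ (univ : Finset (Fin 4 → Fin n)).image resSite, ∑ s ∈ B (n - 1) 0, |qJet n ν b 0 s| :=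
        Finset.sum_congr rfl fun b hb => by rw [hblk b hb]
    _ = ∑ s ∈ B (n - 1) 0, ∑ b ∈ (univ : Finset (Fin 4 → Fin n)).image resSite, |qJet n ν b 0 s| := Finset.sum_comm
    _ ≤ ∑ _s ∈ B (n - 1) (0 : Site 4), ((n : ℝ) - 1) * ((n : ℝ) ^ 4)⁻¹ := Finset.sum_le_sum fun s _ => sum_bond_abs_qJet_le n ν _ 0 s
    _ = (n : ℝ) - 1 := by rw [Finset.sum_const, nsmul_eq_mul, card_B, hmn]; field_simp

end Summit.QuantumFields.BalabanUV.Beta.D1BFx.NeedleNdlNdlCensus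

end
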